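import Summits.AtomisticToContinuum.HydrodynamicLimit.Theses.TwoClocks
import Summits.AtomisticToContinuum.HydrodynamicLimit.Theorems.CorrectorPressureDecay.Negative.Frame
import Summits.AtomisticToContinuum.HydrodynamicLimit.Theorems.TwoClocksEquilibriumShearWindowLDOneParticle
import Summits.AtomisticToContinuum.HydrodynamicLimit.Theorems.TwoClocksEquilibriumShearWindowLD
import Literature.Analysis.FluidPDE.HardSphereMomentumConservation
import Literature.Analysis.FluidPDE.HardSphereTrajectoryMeasurable
import Literature.Probability.Distributions.GaussianCoordinateMoments
import Summits.AtomisticToContinuum.HydrodynamicLimit.Theorems.BoltzmannGreenKubo.Negative.MomentumWitness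

/-!
# `EquilibriumFastWindowLD` — negative knowledge, frame: CONSERVED window sums and their exact moments

Support file for crux `stmt-AtomisticToContinuum-14440` (`TwoClocks.EquilibriumFastWindowLD`), written by
the standing disprover (cdisprove seat). Def-free toolkit behind the load-bearing analysis of the three
orthogonality clauses `F ⊥ 1`, `F ⊥ v_j`, `F ⊥ |v|²` (files `Negative/WithoutOrth*.lean`): the one-body
observables IN the span of the collision invariants have window sums that are CONSERVED along every
hard-sphere flow, so their window exponential moments are STATIC and explicit at every `σ ≤ 1/2`, every
flow, every window and every `N` — the crux minus any one orthogonality clause is then contradicted by an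
exact Gaussian value.

* time-measurability / integrability along good orbits (`intervalIntegrable_comp_flow_of_abs_le`, from
  `IsHardSphereTrajectory.measurable_torus`);
* `windowSum_normSq_eq`, `windowSum_affine_normSq_eq` — `Σᵢ w⁻¹∫₀ʷ (a + b‖vᵢ(r)‖²) dr = Σᵢ (a + b‖vᵢ(0)‖²)`
  on the good set (energy conservation `HardSphereFlow.configEnergy_flow`);
* `windowSum_coord_eq` — `Σᵢ w⁻¹∫₀ʷ vᵢᵏ(r) dr = Σᵢ vᵢᵏ(0)` (momentum conservation
  `HardSphereFlow.configMomentum_flow`);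
* Gaussian values: `lintegral_exp_mul_coord_stdGaussian` (`∫ e^{t wₖ} dγ₃ = e^{t²/2}`, via the sibling
  crux's `BoltzmannGreenKuboOrthMomentum.measurePreserving_coord`),
  `lintegral_exp_mul_normSq_stdGaussian` (`∫ e^{s‖w‖²} dγ₃ = (1-2s)^{-3/2}`, `2s < 1`);
* EXACT WINDOW MOMENTS under the global Gibbs law at rest with `θ₀ = 1` (`σ ≤ 1/2`, any flow, any window):
  `windowMoment_affine_normSq_eq` (`F = a + b‖v‖²`: `(e^{βa}(1-2βb)^{-3/2})^{N+1}`) and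
  `windowMoment_coord_eq` (`F = vₖ`: `(e^{β²/2})^{N+1}`);
* admissibility integrals against the Maxwellian `M_{1,0,1}`: `integral_normSq_mul_localMaxwellian` (= 3),
  `integral_normSq_sq_mul_localMaxwellian` (= 15), odd moments vanish (`integral_coord_mul_even_localMaxwellian`).

All `[folklore]`.
-/

noncomputable section

open MeasureTheory ProbabilityTheory Real Set
open scoped ENNReal

namespace Summit.AtomisticToContinuum.HydrodynamicLimit.Theorems.EquilibriumFastWindowLDNegative

open Literature.Analysis.FluidPDE Literature.MathematicalPhysics.KineticTheory
open Summit.AtomisticToContinuum.HydrodynamicLimit.Theorems.CorrectorPressureDecayNegative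

/-! ## Time integrability along good orbits -/

/-- A real observable of a good orbit, measurable and uniformly bounded in time, is interval integrable
on every window (the orbit is Borel measurable in time, `IsHardSphereTrajectory.measurable_torus`).
[folklore] -/
theorem intervalIntegrable_comp_flow_of_abs_le {ε : ℝ} {n : ℕ}
    (Φ : HardSphereFlow (Torus.geometry (Fin 3)) ε n) {z : Config n (Fin 3) T3} (hz : z ∈ Φ.good)
    {H : Config n (Fin 3) T3 → ℝ} (hH : Measurable H) {C : ℝ} (hC : ∀ r, |H (Φ.flow r z)| ≤ C)
    (a b : ℝ) : IntervalIntegrable (fun r => H (Φ.flow r z)) volume a b := by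
  have hm : Measurable fun r => H (Φ.flow r z) := hH.comp (Φ.isTrajectory z hz).measurable_torus
  refine (intervalIntegrable_const (c := C)).mono_fun' hm.aestronglyMeasurable ?_
  exact ae_of_all _ fun r => by simpa [Real.norm_eq_abs] using hC r

/-- Speeds are bounded along a good orbit: `‖vᵢ(r)‖² ≤ 2E(z)`. [folklore] -/
theorem norm_vel_flow_sq_le {ε : ℝ} {n : ℕ} (Φ : HardSphereFlow (Torus.geometry (Fin 3)) ε n)
    {z : Config n (Fin 3) T3} (hz : z ∈ Φ.good) (r : ℝ) (i : Fin n) :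
    ‖(Φ.flow r z i).2‖ ^ 2 ≤ 2 * configEnergy z := by
  have := norm_vel_sq_le_two_mul_configEnergy (Φ.flow r z) i
  rwa [Φ.configEnergy_flow hz r] at this

/-- The squared speed of particle `i` is interval integrable along a good orbit. [folklore] -/
theorem intervalIntegrable_normSq_vel_flow {ε : ℝ} {n : ℕ}
    (Φ : HardSphereFlow (Torus.geometry (Fin 3)) ε n) {z : Config n (Fin 3) T3} (hz : z ∈ Φ.good)
    (i : Fin n) (a b : ℝ) :
    IntervalIntegrable (fun r => ‖(Φ.flow r z i).2‖ ^ 2) volume a b := by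
  have hH : Measurable fun w : Config n (Fin 3) T3 => ‖(w i).2‖ ^ 2 :=
    ((measurable_pi_apply i).snd.norm).pow_const 2
  refine intervalIntegrable_comp_flow_of_abs_le Φ hz hH (C := 2 * configEnergy z) (fun r => ?_) a b
  rw [abs_of_nonneg (sq_nonneg _)]
  exact norm_vel_flow_sq_le Φ hz r i

/-- A velocity component of particle `i` is interval integrable along a good orbit. [folklore] -/
theorem intervalIntegrable_coord_vel_flow {ε : ℝ} {n : ℕ}
    (Φ : HardSphereFlow (Torus.geometry (Fin 3)) ε n) {z : Config n (Fin 3) T3} (hz : z ∈ Φ.good)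
    (i : Fin n) (k : Fin 3) (a b : ℝ) :
    IntervalIntegrable (fun r => (Φ.flow r z i).2 k) volume a b := by
  have hH : Measurable fun w : Config n (Fin 3) T3 => (w i).2 k :=
    (EuclideanSpace.proj (𝕜 := ℝ) k).continuous.measurable.comp (measurable_pi_apply i).snd
  refine intervalIntegrable_comp_flow_of_abs_le Φ hz hH (C := 1 + 2 * configEnergy z) (fun r => ?_) a b
  have h1 : |(Φ.flow r z i).2 k| ≤ ‖(Φ.flow r z i).2‖ := by
    simpa [Real.norm_eq_abs] using PiLp.norm_apply_le (Φ.flow r z i).2 k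
  have h2 : ‖(Φ.flow r z i).2‖ ≤ 1 + ‖(Φ.flow r z i).2‖ ^ 2 := by
    nlinarith [norm_nonneg (Φ.flow r z i).2, sq_nonneg (‖(Φ.flow r z i).2‖ - 1)]
  exact h1.trans (h2.trans (by linarith [norm_vel_flow_sq_le Φ hz r i]))

/-! ## Conserved window sums -/

/-- **The window sum of the kinetic energies is conserved**: on the good set, for `w > 0`,
`Σᵢ w⁻¹∫₀ʷ ‖vᵢ(r)‖² dr = Σᵢ ‖vᵢ(0)‖²` (= `2E(z)`). [folklore] -/
theorem windowSum_normSq_eq {ε : ℝ} {n : ℕ} (Φ : HardSphereFlow (Torus.geometry (Fin 3)) ε n)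
    {z : Config n (Fin 3) T3} (hz : z ∈ Φ.good) {w : ℝ} (hw : 0 < w) :
    ∑ i, w⁻¹ * ∫ r in (0 : ℝ)..w, ‖(Φ.flow r z i).2‖ ^ 2 = ∑ i, ‖(z i).2‖ ^ 2 := by
  rw [← Finset.mul_sum, ← intervalIntegral.integral_finsetSum
    (fun i _ => intervalIntegrable_normSq_vel_flow Φ hz i 0 w)]
  have hconst : ∀ r, ∑ i, ‖(Φ.flow r z i).2‖ ^ 2 = 2 * configEnergy z := by
    intro r
    rw [← Φ.configEnergy_flow hz r, configEnergy]
    ring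
  have hz0 : ∑ i, ‖(z i).2‖ ^ 2 = 2 * configEnergy z := by rw [configEnergy]; ring
  simp_rw [hconst]
  rw [intervalIntegral.integral_const, sub_zero, smul_eq_mul, ← mul_assoc, inv_mul_cancel₀ hw.ne',
    one_mul, hz0]

/-- **Affine functions of the kinetic energy have conserved window sums**: on the good set, for `w > 0`,
`Σᵢ w⁻¹∫₀ʷ (a + b‖vᵢ(r)‖²) dr = Σᵢ (a + b‖vᵢ(0)‖²)`. [folklore] -/
theorem windowSum_affine_normSq_eq {ε : ℝ} {n : ℕ} (Φ : HardSphereFlow (Torus.geometry (Fin 3)) ε n)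
    {z : Config n (Fin 3) T3} (hz : z ∈ Φ.good) (a b : ℝ) {w : ℝ} (hw : 0 < w) :
    ∑ i, w⁻¹ * ∫ r in (0 : ℝ)..w, (a + b * ‖(Φ.flow r z i).2‖ ^ 2) = ∑ i, (a + b * ‖(z i).2‖ ^ 2) := by
  have hsplit : ∀ i, w⁻¹ * ∫ r in (0 : ℝ)..w, (a + b * ‖(Φ.flow r z i).2‖ ^ 2) =
      a + b * (w⁻¹ * ∫ r in (0 : ℝ)..w, ‖(Φ.flow r z i).2‖ ^ 2) := by
    intro i
    have hI := intervalIntegrable_normSq_vel_flow Φ hz i 0 w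
    rw [intervalIntegral.integral_add intervalIntegrable_const (hI.const_mul b),
      intervalIntegral.integral_const, intervalIntegral.integral_const_mul, sub_zero, smul_eq_mul,
      mul_add, ← mul_assoc, inv_mul_cancel₀ hw.ne', one_mul]
    ring
  calc ∑ i, w⁻¹ * ∫ r in (0 : ℝ)..w, (a + b * ‖(Φ.flow r z i).2‖ ^ 2)
      = ∑ i, (a + b * (w⁻¹ * ∫ r in (0 : ℝ)..w, ‖(Φ.flow r z i).2‖ ^ 2)) := Finset.sum_congr rfl fun i _ => hsplit i
    _ = ∑ _i : Fin n, a + b * ∑ i, w⁻¹ * ∫ r in (0 : ℝ)..w, ‖(Φ.flow r z i).2‖ ^ 2 := by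
        rw [Finset.sum_add_distrib, Finset.mul_sum]
    _ = ∑ _i : Fin n, a + b * ∑ i, ‖(z i).2‖ ^ 2 := by rw [windowSum_normSq_eq Φ hz hw]
    _ = ∑ i, (a + b * ‖(z i).2‖ ^ 2) := by rw [Finset.sum_add_distrib, Finset.mul_sum]

/-- **The window sum of a momentum component is conserved**: on the good set, for `w > 0`,
`Σᵢ w⁻¹∫₀ʷ vᵢᵏ(r) dr = Σᵢ vᵢᵏ(0)`. [folklore] -/
theorem windowSum_coord_eq {ε : ℝ} {n : ℕ} (Φ : HardSphereFlow (Torus.geometry (Fin 3)) ε n)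
    {z : Config n (Fin 3) T3} (hz : z ∈ Φ.good) (k : Fin 3) {w : ℝ} (hw : 0 < w) :
    ∑ i, w⁻¹ * ∫ r in (0 : ℝ)..w, (Φ.flow r z i).2 k = ∑ i, (z i).2 k := by
  rw [← Finset.mul_sum, ← intervalIntegral.integral_finsetSum
    (fun i _ => intervalIntegrable_coord_vel_flow Φ hz i k 0 w)]
  have hconst : ∀ r, ∑ i, (Φ.flow r z i).2 k = ∑ i, (z i).2 k := by
    intro r
    have h := congrArg (fun p : V3 => p k) (Φ.configMomentum_flow hz r)
    simpa [configMomentum] using h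
  simp_rw [hconst]
  rw [intervalIntegral.integral_const, sub_zero, smul_eq_mul, ← mul_assoc, inv_mul_cancel₀ hw.ne',
    one_mul]

/-! ## Gaussian values on `ℝ³` -/

/-- **Linear exponential moment of a coordinate**: `∫ e^{t wₖ} dγ₃(w) = e^{t²/2}` (coordinate marginal
`BoltzmannGreenKuboOrthMomentum.measurePreserving_coord` + the real Gaussian mgf). [folklore] -/
theorem lintegral_exp_mul_coord_stdGaussian (t : ℝ) (k : Fin 3) :
    ∫⁻ w, ENNReal.ofReal (Real.exp (t * w k)) ∂(stdGaussian V3) = ENNReal.ofReal (Real.exp (t ^ 2 / 2)) := by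
  have hf : Measurable fun x : ℝ => ENNReal.ofReal (Real.exp (t * x)) := by fun_prop
  rw [← lintegral_exp_mul_gaussianReal t]
  exact (BoltzmannGreenKuboOrthMomentum.measurePreserving_coord k).lintegral_comp hf

/-- **Quadratic exponential moment of the speed**: for `2s < 1`, `∫ e^{s‖w‖²} dγ₃(w) = ((1-2s)^{-1/2})³`
(independent coordinates, `lintegral_exp_mul_sq_gaussianReal` in each). [folklore] -/
theorem lintegral_exp_mul_normSq_stdGaussian {s : ℝ} (hs : 2 * s < 1) :
    ∫⁻ w, ENNReal.ofReal (Real.exp (s * ‖w‖ ^ 2)) ∂(stdGaussian V3) =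
      ENNReal.ofReal ((1 - 2 * s) ^ (-(1 / 2 : ℝ))) ^ 3 := by
  set μ : Fin 3 → Measure ℝ := fun _ => gaussianReal 0 1 with hμ
  have hGm : Measurable fun w : V3 => ENNReal.ofReal (Real.exp (s * ‖w‖ ^ 2)) := by fun_prop
  have h1 : ∫⁻ w, ENNReal.ofReal (Real.exp (s * ‖w‖ ^ 2)) ∂(stdGaussian V3) =
      ∫⁻ x, ENNReal.ofReal (Real.exp (s * ‖(WithLp.toLp 2 x : V3)‖ ^ 2)) ∂(Measure.pi μ) := by
    rw [hμ, ← map_pi_eq_stdGaussian, lintegral_map hGm (PiLp.continuous_toLp 2 _).measurable]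
  rw [h1]
  have h2 : ∀ x : Fin 3 → ℝ, ENNReal.ofReal (Real.exp (s * ‖(WithLp.toLp 2 x : V3)‖ ^ 2)) =
      ∏ k : Fin 3, ENNReal.ofReal (Real.exp (s * x k ^ 2)) := by
    intro x
    rw [EuclideanSpace.real_norm_sq_eq, Finset.mul_sum, Real.exp_sum,
      ENNReal.ofReal_prod_of_nonneg fun k _ => (Real.exp_pos _).le]
  simp_rw [h2]
  rw [show (∫⁻ x : Fin 3 → ℝ, ∏ k : Fin 3, ENNReal.ofReal (Real.exp (s * x k ^ 2)) ∂(Measure.pi μ)) =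
      ∫⁻ x : Fin 3 → ℝ, ∏ k : Fin 3, (fun (_ : Fin 3) (y : ℝ) => ENNReal.ofReal (Real.exp (s * y ^ 2))) k (x k)
        ∂(Measure.pi μ) from rfl,
    lintegral_fintype_prod_eq_prod' (f := fun (_ : Fin 3) (y : ℝ) => ENNReal.ofReal (Real.exp (s * y ^ 2))) μ
      (fun _ => by fun_prop)]
  simp only [hμ, Finset.prod_const, Finset.card_univ, Fintype.card_fin]
  rw [lintegral_exp_mul_sq_gaussianReal hs]

/-! ## Exact window moments under the global Gibbs law at rest (`θ₀ = 1`) -/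

/-- **Exact window exponential moment of `F = a + b‖v‖²`** (any `σ ≤ 1/2`, any flow, any window `w > 0`,
`a₀ > 0`, `θ₀ = 1`, `u₀ = 0`, `2βb < 1`):
`∫ exp(β Σᵢ w⁻¹∫₀ʷ (a + b‖vᵢ(r)‖²) dr) dG_N = (e^{βa} ((1-2βb)^{-1/2})³)^{N+1}`. The window sum is
conserved, so the moment is the static one-body product. [folklore] -/
theorem windowMoment_affine_normSq_eq {a₀ : ℝ} (ha : 0 < a₀) {σ : ℝ} (hσ2 : σ ≤ 1 / 2) (N : ℕ)
    (Φ : HardSphereFlow (Torus.geometry (Fin 3)) (hsDiameter σ N) (N + 1)) (a b : ℝ) {β : ℝ}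
    (hβb : 2 * (β * b) < 1) {w : ℝ} (hw : 0 < w) :
    ∫⁻ z, ENNReal.ofReal (Real.exp (β * ∑ i : Fin (N + 1),
        w⁻¹ * ∫ r in (0 : ℝ)..w, (a + b * ‖(Φ.flow r z i).2‖ ^ 2)))
        ∂(localGibbsLaw σ (fun _ => a₀) (fun _ => 0) (fun _ => 1) N Φ) =
      (ENNReal.ofReal (Real.exp (β * a)) * ENNReal.ofReal ((1 - 2 * (β * b)) ^ (-(1 / 2 : ℝ))) ^ 3) ^
        (N + 1) := by
  have hae : ∀ᵐ z ∂(localGibbsLaw σ (fun _ => a₀) (fun _ => 0) (fun _ => 1) N Φ), z ∈ Φ.good :=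
    mem_ae_iff.2 (localGibbsLaw_const_compl_good σ a₀ 1 0 N Φ)
  have hcongr : ∫⁻ z, ENNReal.ofReal (Real.exp (β * ∑ i : Fin (N + 1),
        w⁻¹ * ∫ r in (0 : ℝ)..w, (a + b * ‖(Φ.flow r z i).2‖ ^ 2)))
        ∂(localGibbsLaw σ (fun _ => a₀) (fun _ => 0) (fun _ => 1) N Φ) =
      ∫⁻ z, ENNReal.ofReal (Real.exp (∑ i : Fin (N + 1), (fun v : V3 => β * (a + b * ‖v‖ ^ 2)) (z i).2))
        ∂(localGibbsLaw σ (fun _ => a₀) (fun _ => 0) (fun _ => 1) N Φ) := by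
    refine lintegral_congr_ae ?_
    filter_upwards [hae] with z hz
    rw [windowSum_affine_normSq_eq Φ hz a b hw, Finset.mul_sum]
  rw [hcongr, localGibbsLaw_eq, lintegral_exp_sum_vel_localGibbsMeasure ha one_pos (0 : V3) hσ2 N
    (by fun_prop : Measurable fun v : V3 => β * (a + b * ‖v‖ ^ 2)), gaussMeasure_zero_one]
  congr 1
  have hpt : ∀ w' : V3, ENNReal.ofReal (Real.exp (β * (a + b * ‖w'‖ ^ 2))) =
      ENNReal.ofReal (Real.exp (β * a)) * ENNReal.ofReal (Real.exp ((β * b) * ‖w'‖ ^ 2)) := by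
    intro w'
    rw [← ENNReal.ofReal_mul (Real.exp_pos _).le, ← Real.exp_add]
    congr 2
    ring
  simp_rw [hpt]
  rw [lintegral_const_mul _ (by fun_prop), lintegral_exp_mul_normSq_stdGaussian hβb]

/-- **Exact window exponential moment of a velocity component `F = vₖ`** (any `σ ≤ 1/2`, any flow, any
window `w > 0`, `a₀ > 0`, `θ₀ = 1`, `u₀ = 0`): `∫ exp(β Σᵢ w⁻¹∫₀ʷ vᵢᵏ(r) dr) dG_N = (e^{β²/2})^{N+1}`
(the window sum is the conserved momentum). [folklore] -/
theorem windowMoment_coord_eq {a₀ : ℝ} (ha : 0 < a₀) {σ : ℝ} (hσ2 : σ ≤ 1 / 2) (N : ℕ)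
    (Φ : HardSphereFlow (Torus.geometry (Fin 3)) (hsDiameter σ N) (N + 1)) (k : Fin 3) (β : ℝ)
    {w : ℝ} (hw : 0 < w) :
    ∫⁻ z, ENNReal.ofReal (Real.exp (β * ∑ i : Fin (N + 1), w⁻¹ * ∫ r in (0 : ℝ)..w, (Φ.flow r z i).2 k))
        ∂(localGibbsLaw σ (fun _ => a₀) (fun _ => 0) (fun _ => 1) N Φ) =
      ENNReal.ofReal (Real.exp (β ^ 2 / 2)) ^ (N + 1) := by
  have hae : ∀ᵐ z ∂(localGibbsLaw σ (fun _ => a₀) (fun _ => 0) (fun _ => 1) N Φ), z ∈ Φ.good :=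
    mem_ae_iff.2 (localGibbsLaw_const_compl_good σ a₀ 1 0 N Φ)
  have hcongr : ∫⁻ z, ENNReal.ofReal (Real.exp (β * ∑ i : Fin (N + 1),
        w⁻¹ * ∫ r in (0 : ℝ)..w, (Φ.flow r z i).2 k))
        ∂(localGibbsLaw σ (fun _ => a₀) (fun _ => 0) (fun _ => 1) N Φ) =
      ∫⁻ z, ENNReal.ofReal (Real.exp (∑ i : Fin (N + 1), (fun v : V3 => β * v k) (z i).2))
        ∂(localGibbsLaw σ (fun _ => a₀) (fun _ => 0) (fun _ => 1) N Φ) := by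
    refine lintegral_congr_ae ?_
    filter_upwards [hae] with z hz
    rw [windowSum_coord_eq Φ hz k hw, Finset.mul_sum]
  rw [hcongr, localGibbsLaw_eq, lintegral_exp_sum_vel_localGibbsMeasure ha one_pos (0 : V3) hσ2 N
    (by fun_prop : Measurable fun v : V3 => β * v k), gaussMeasure_zero_one,
    lintegral_exp_mul_coord_stdGaussian β k]

/-! ## Admissibility integrals against the Maxwellian `M_{1,0,1}` -/

/-- Integrals against `M_{1,0,1}(v) dv` are standard-Gaussian integrals. [folklore] -/
theorem integral_mul_localMaxwellian_one_zero (g : V3 → ℝ) :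
    ∫ v, g v * localMaxwellian 1 1 (0 : V3) v = ∫ w, g w ∂stdGaussian V3 := by
  have h := integral_localMaxwellian_smul (E := V3) one_pos (0 : V3) g
  simp only [smul_eq_mul, Real.sqrt_one, one_smul, zero_add] at h
  simp_rw [mul_comm (g _)]
  exact h

/-- `∫ ‖v‖² M_{1,0,1}(v) dv = 3`. [folklore] -/
theorem integral_normSq_mul_localMaxwellian : ∫ v : V3, ‖v‖ ^ 2 * localMaxwellian 1 1 (0 : V3) v = 3 := by
  rw [integral_mul_localMaxwellian_one_zero, integral_norm_sq_stdGaussian]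
  simp

/-- `∫ ‖v‖⁴ M_{1,0,1}(v) dv = 15` (Wick: `d(d+2)` at `d = 3`,
`Literature.Probability.Distributions.integral_norm_pow_four_stdGaussian`). [folklore] -/
theorem integral_normSq_sq_mul_localMaxwellian :
    ∫ v : V3, ‖v‖ ^ 4 * localMaxwellian 1 1 (0 : V3) v = 15 := by
  rw [integral_mul_localMaxwellian_one_zero,
    Literature.Probability.Distributions.integral_norm_pow_four_stdGaussian (EuclideanSpace.basisFun (Fin 3) ℝ)]
  norm_num

/-- `∫ M_{1,0,1}(v) dv = 1`. [folklore] -/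
theorem integral_one_mul_localMaxwellian : ∫ v : V3, (1 : ℝ) * localMaxwellian 1 1 (0 : V3) v = 1 := by
  rw [integral_mul_localMaxwellian_one_zero, integral_const, smul_eq_mul, mul_one, probReal_univ]

/-- **`F = a + b‖v‖²` against the Maxwellian**: `∫ (a + b‖v‖²) M = a + 3b`. [folklore] -/
theorem integral_affine_normSq_mul_localMaxwellian (a b : ℝ) :
    ∫ v : V3, (a + b * ‖v‖ ^ 2) * localMaxwellian 1 1 (0 : V3) v = a + 3 * b := by
  rw [integral_mul_localMaxwellian_one_zero, integral_add (integrable_const a)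
    (integrable_norm_sq_stdGaussian.const_mul b), integral_const, integral_const_mul,
    integral_norm_sq_stdGaussian, probReal_univ, one_smul]
  simp only [Fintype.card_fin, Nat.cast_ofNat]
  ring

/-- **`F = a + b‖v‖²` against `|v|² M`**: `∫ (a + b‖v‖²)‖v‖² M = 3a + 15b`. [folklore] -/
theorem integral_affine_normSq_mul_normSq_mul_localMaxwellian (a b : ℝ) :
    ∫ v : V3, (a + b * ‖v‖ ^ 2) * ‖v‖ ^ 2 * localMaxwellian 1 1 (0 : V3) v = 3 * a + 15 * b := by
  have h4 : ∀ v : V3, (a + b * ‖v‖ ^ 2) * ‖v‖ ^ 2 = a * ‖v‖ ^ 2 + b * ‖v‖ ^ 4 := fun v => by ring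
  simp_rw [h4]
  rw [integral_mul_localMaxwellian_one_zero, integral_add (integrable_norm_sq_stdGaussian.const_mul a)
    (integrable_norm_pow_four_stdGaussian.const_mul b), integral_const_mul, integral_const_mul,
    integral_norm_sq_stdGaussian,
    Literature.Probability.Distributions.integral_norm_pow_four_stdGaussian (EuclideanSpace.basisFun (Fin 3) ℝ)]
  simp only [Fintype.card_fin, Nat.cast_ofNat]
  ring

/-- **Functions of the speed are orthogonal to every velocity component** under `M_{1,0,θ}` (odd under
`v_j ↦ -v_j`; no integrability needed). [folklore] -/
theorem integral_radial_mul_coord_mul_localMaxwellian (g : ℝ → ℝ) (θ : ℝ) (j : Fin 3) :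
    ∫ v : V3, g (‖v‖ ^ 2) * v j * localMaxwellian 1 θ (0 : V3) v = 0 := by
  obtain ⟨R, hR⟩ := exists_velFlip j
  refine integral_eq_zero_of_odd_linearIsometryEquiv R fun v => ?_
  rw [localMaxwellian_linearIsometryEquiv, hR v j, if_pos rfl, LinearIsometryEquiv.norm_map]
  ring

/-- **A velocity component is orthogonal to the constants** under `M_{1,0,θ}`. [folklore] -/
theorem integral_coord_mul_localMaxwellian (θ : ℝ) (k : Fin 3) :
    ∫ v : V3, v k * localMaxwellian 1 θ (0 : V3) v = 0 := by
  have h := integral_radial_mul_coord_mul_localMaxwellian (fun _ => 1) θ k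
  simpa using h

/-- **A velocity component is orthogonal to the kinetic energy** under `M_{1,0,θ}`. [folklore] -/
theorem integral_coord_mul_normSq_mul_localMaxwellian (θ : ℝ) (k : Fin 3) :
    ∫ v : V3, v k * ‖v‖ ^ 2 * localMaxwellian 1 θ (0 : V3) v = 0 := by
  have h := integral_radial_mul_coord_mul_localMaxwellian (fun s => s) θ k
  simp only at h
  simpa [mul_comm (‖_‖ ^ 2)] using h

/-- **Products of two distinct velocity components are odd**: `∫ vₖ vⱼ M = 0` for `j ≠ k`, and
`∫ vₖ vₖ M`… is not claimed (it is `θ`). Stated for the witness `F = vₖ`: `∫ vₖ · vⱼ · M = 0` when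
`j ≠ k`. [folklore] -/
theorem integral_coord_mul_coord_mul_localMaxwellian_of_ne (θ : ℝ) {j k : Fin 3} (hjk : j ≠ k) :
    ∫ v : V3, v k * v j * localMaxwellian 1 θ (0 : V3) v = 0 := by
  obtain ⟨R, hR⟩ := exists_velFlip j
  refine integral_eq_zero_of_odd_linearIsometryEquiv R fun v => ?_
  rw [localMaxwellian_linearIsometryEquiv, hR v j, hR v k, if_pos rfl, if_neg (Ne.symm hjk)]
  ring

end Summit.AtomisticToContinuum.HydrodynamicLimit.Theorems.EquilibriumFastWindowLDNegative

end
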